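import Literature.NumberTheory.Rogawski1990.ArchHCSpaceG                 -- ★ `hcNrm`, `hcCayPt`, `hcAdaptedVec`, `hcCayVec`, `hcCayScalar`, `hcThird`
import Literature.Analysis.Calculus.IteratedFDerivParamWordsLocal        -- ★ p850991 (F0P3a-p08 (g23)): local reader normal form
import Mathlib.Analysis.Calculus.ContDiff.Basic
import HarnessLib

/-!
# The adapted∕Cayley letter algebra of ★ `ArchHCSpaceG` in the coordinates `(π c, ν c)` ∕ `(B c″, x c″)`, and the cofactor WICK identity in word form
# (Shelstad 1979 Lemma 4.3; Bouaziz 1994 §3.2 (I₃); Harish-Chandra's `|D_{G∕M}|^{1∕2}`)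

Topic `NumberTheory/Rogawski1990`; namespace `Literature.NumberTheory.Rogawski1990`.  THEOREMS ONLY (no `def`, no instance, no notation, no axiom, no named fact, no `sorry`);
GROUP-FREE (an index type `W` of places).  Cell `pub/hodgecm-mathlib`, crux H413 (`stmt-HodgeConjecture-24833`), F0∕P3c line LH3 (letter L1 clause (I₃) `ArchHcJump`),
SPEC-I3 brick **(B-trans)** (F0P3a-p08 (g23)), FILE 2a.

THE COORDINATES at the noncompact wall `(w, i, j)` (`i ≠ j`, third slot `k = hcThird i j`).  Compact chart: normal coordinate `ν c = (c w i − c w j)∕2`, wall projection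
`π c = c − ν c • hcNrm w i j`.  Split chart `insert w S′` (slots `0 = x`, `1 =` compact-line angle, `2 = θ`): `x c″ = c″ w 0` and the linear map
`B c″ = update c″ w (fun l => if l = k then c″ w 1 else c″ w 2)` — it READS the split chart's transversal slots back into wall coordinates: **`B (hcCayPt w i j p) = p` on the wall**
(`p w i = p w j`) and `B ∘ hcCayVec = π ∘ hcAdaptedVec` LETTER BY LETTER, both `0` on the normal letter `(w,i)`; `ν (hcAdaptedVec l) = [l = (w,i)]`, `x (hcCayVec l) = [l = (w,i)]`.
Hence the adapted word of the compact chart and the Cayley word of the split chart become THE SAME word of `(π, ν)`∕`(B, x)`-letters `(0,1)` (normal) ∕ `(v,0)` (transversal)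
(§1–§2), which is why ★ `iteratedFDeriv_readers_eq_iteratedDeriv_foldr_local` produces ONE differentiated family for both charts.  §3: the sub-word counts (`hcCayScalar`).
§4 **COFACTOR WICK IN WORD FORM**: for `M₁(q,t) = K₁·(ce t·Π q − E q)`, `M₂(q,t) = K₂·(ch t·Π q − E q)` (`Π, E` `C^∞` on an open `Q`, `ce, ch` `C^∞` with
`iteratedDeriv a ce 0 = I^a · iteratedDeriv a ch 0` — `ce = 2cos`, `ch = 2cosh` in the line's use, ★ LH1-p03 (R4)) and every word of normal∕transversal letters:
`K₂ · iteratedFDeriv k M₁ (q,0) w = K₁ · I^{#normal} · iteratedFDeriv k M₂ (q,0) w` — Harish-Chandra's «the `G′∕M` cofactor is ONE invariant function read on both Cartans».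
HONEST LABEL: count-neutral calculus; HC_CM is proved only modulo the 7 printed citations (2 remaining: hLiu418 = stmt-HodgeConjecture-24832, h413 = stmt-HodgeConjecture-24833)
until rung 0 closes.

## References
* [Shelstad1979] D. Shelstad, *Characters and inner forms of a quasi-split group over ℝ*, Compositio Math. 39 (1979), Lemma 4.3 p. 25 (adapted basis `I⁺`, Cayley images, the factor `i`).
* [Bouaziz1994IntegralesOrbitales] A. Bouaziz, *Intégrales orbitales sur les groupes de Lie réductifs*, Ann. Sci. ÉNS 27 (1994), §3.2 (I₃) p. 580 (`∂(u)`, `∂(r(c_α · u))`).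
* [Varadarajan1977] V. S. Varadarajan, *Harmonic Analysis on Real Reductive Groups*, LNM 576 (1977), Part I §1.12 (`'F_f`, descent, `D_{G∕M}`).
-/

set_option autoImplicit false

open Set Filter Function Finset Complex
open scoped Topology ContDiff

namespace Literature.NumberTheory.Rogawski1990

variable {W : Type*} [DecidableEq W]

/-! ## §1 The letters in coordinates -/

section Letters

/-- A slot of `Fin 3` different from both members of a pair `i ≠ j` IS the third slot (private copy of ★ `ArchTransfFamilyWallGeometry`'s lemma, to keep the import
closure light). [cite: Shelstad1979, §4 p. 25] -/
private theorem eq_hcThird_of_ne_ne_local {i j k : Fin 3} (hij : i ≠ j) (hki : k ≠ i) (hkj : k ≠ j) : k = hcThird i j := by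
  unfold hcThird; revert i j k; decide

/-- The normal letter has normal coordinate `1`: `(hcNrm w i j) w i − (hcNrm w i j) w j = 2`. [cite: Shelstad1979, Lemma 4.3 (p. 25)] -/
theorem hcNrm_apply_sub {i j : Fin 3} (hij : i ≠ j) (w : W) : hcNrm w i j w i - hcNrm w i j w j = 2 := by
  simp [hcNrm, hij, hij.symm]; norm_num

/-- `hcNrm` vanishes at the other places. [cite: Shelstad1979, Lemma 4.3 (p. 25)] -/
theorem hcNrm_apply_of_ne {w w' : W} (h : w' ≠ w) (i j : Fin 3) : hcNrm w i j w' = 0 := by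
  simp [hcNrm, h]

/-- **Normal coordinate of the adapted letters**: `ν (hcAdaptedVec l) = 1` for the normal letter `(w,i)`, `0` for every other letter. [cite: Shelstad1979, Lemma 4.3 (p. 25)] -/
theorem hcAdaptedVec_apply_sub {i j : Fin 3} (hij : i ≠ j) (w : W) (l : W × Fin 3) :
    hcAdaptedVec w i j l w i - hcAdaptedVec w i j l w j = if l = (w, i) then 2 else 0 := by
  obtain ⟨w', l'⟩ := l
  by_cases hw : w' = w
  · subst hw
    by_cases hi : l' = i
    · subst hi; simp [hcAdaptedVec, hij, hij.symm]; norm_num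
    · by_cases hj : l' = j
      · subst hj; simp [hcAdaptedVec, hij, hij.symm]
      · simp [hcAdaptedVec, hi, hj, Ne.symm hi, Ne.symm hj]
  · simp [hcAdaptedVec, hw, Ne.symm hw]

/-- **`x`-coordinate of the Cayley letters**: `(hcCayVec l) w 0 = 1` for the normal letter, `0` otherwise. [cite: Shelstad1979, Lemma 4.3 (p. 25)] -/
theorem hcCayVec_apply_zero (w : W) {i j : Fin 3} (hij : i ≠ j) (l : W × Fin 3) :
    hcCayVec w i j l w 0 = if l = (w, i) then 1 else 0 := by
  obtain ⟨w', l'⟩ := l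
  by_cases hw : w' = w
  · subst hw
    by_cases hi : l' = i
    · subst hi; simp [hcCayVec]
    · by_cases hj : l' = j
      · subst hj; simp [hcCayVec, hi]
      · simp [hcCayVec, hi, hj]
  · simp [hcCayVec, hw, Ne.symm hw]

/-- **`B` reads the Cayley letters back as adapted letters**: for every letter `l ≠ (w,i)`,
`update (hcCayVec l) w (fun s => if s = k then (hcCayVec l) w 1 else (hcCayVec l) w 2) = hcAdaptedVec l`. [cite: Shelstad1979, Lemma 4.3 (p. 25)] -/
theorem update_hcCayVec_eq_hcAdaptedVec (w : W) {i j : Fin 3} (hij : i ≠ j) {l : W × Fin 3} (hl : l ≠ (w, i)) :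
    Function.update (hcCayVec w i j l) w (fun s => if s = hcThird i j then hcCayVec w i j l w 1 else hcCayVec w i j l w 2) = hcAdaptedVec w i j l := by
  obtain ⟨w', l'⟩ := l
  have h3i := hcThird_ne_left hij
  have h3j := hcThird_ne_right hij
  funext w'' s
  by_cases hw : w' = w
  · subst hw
    have hi : l' ≠ i := fun h => hl (by rw [h])
    by_cases hj : l' = j
    · subst hj
      by_cases hw'' : w'' = w'
      · subst hw''
        simp only [hcCayVec, hcAdaptedVec, hi, if_true, if_false, Function.update_self, Pi.single_eq_same, Pi.add_apply]
        simp only [Pi.single_eq_of_ne (show (1 : Fin 3) ≠ 2 by decide)]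
        by_cases hs : s = hcThird i l'
        · rw [if_pos hs, Pi.single_apply, Pi.single_apply, if_neg (hs ▸ h3i), if_neg (hs ▸ h3j), add_zero]
        · rw [if_neg hs]
          rcases eq_or_ne s i with rfl | hsi
          · rw [Pi.single_eq_same, Pi.single_apply, if_neg hij, add_zero]
          · rcases eq_or_ne s l' with rfl | hsj
            · rw [Pi.single_eq_same, Pi.single_apply, if_neg hsi, zero_add]
            · exact absurd (eq_hcThird_of_ne_ne_local hij hsi hsj) hs
      · simp [hcCayVec, hcAdaptedVec, hi, hw'']
    · have hk : l' = hcThird i j := eq_hcThird_of_ne_ne_local hij hi hj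
      by_cases hw'' : w'' = w'
      · subst hw''
        simp only [hcCayVec, hcAdaptedVec, hi, hj, if_true, if_false, Function.update_self, Pi.single_eq_same]
        simp only [Pi.single_eq_of_ne (show (2 : Fin 3) ≠ 1 by decide)]
        rw [Pi.single_apply, hk, eq_comm]
      · simp [hcCayVec, hcAdaptedVec, hi, hj, hw'']
  · have hupd : Function.update (hcCayVec w i j (w', l')) w (fun s => if s = hcThird i j then hcCayVec w i j (w', l') w 1 else hcCayVec w i j (w', l') w 2)
        = hcCayVec w i j (w', l') := by
      apply Function.update_eq_self_iff.2
      funext s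
      simp [hcCayVec, hw, Ne.symm hw]
    rw [hupd]
    simp [hcCayVec, hcAdaptedVec, hw]

/-- `B` kills the Cayley image `e_{w,0} = ∂ₓ` of the normal letter. [cite: Shelstad1979, Lemma 4.3 (p. 25)] -/
theorem update_hcCayVec_normal_eq_zero (w : W) (i j : Fin 3) :
    Function.update (hcCayVec w i j (w, i)) w (fun s => if s = hcThird i j then hcCayVec w i j (w, i) w 1 else hcCayVec w i j (w, i) w 2) = 0 := by
  funext w'' s
  by_cases hw'' : w'' = w
  · subst hw''; simp [hcCayVec]
  · simp [hcCayVec, hw'']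

/-- `π` kills the normal letter: `hcNrm − ((hcNrm w i − hcNrm w j)∕2) • hcNrm = 0`. [cite: Shelstad1979, Lemma 4.3 (p. 25)] -/
theorem hcNrm_sub_smul_self {i j : Fin 3} (hij : i ≠ j) (w : W) :
    hcNrm w i j - ((hcNrm w i j w i - hcNrm w i j w j) / 2) • hcNrm w i j = 0 := by
  rw [hcNrm_apply_sub hij]; norm_num

/-- **`B (hcCayPt p) = p` on the wall** (`p w i = p w j`). [cite: Shelstad1979, §4 p. 25] -/
theorem update_hcCayPt_eq_self (w : W) {i j : Fin 3} (hij : i ≠ j) {p : W → Fin 3 → ℝ} (hp : p w i = p w j) :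
    Function.update (hcCayPt w i j p) w (fun s => if s = hcThird i j then hcCayPt w i j p w 1 else hcCayPt w i j p w 2) = p := by
  funext w'' s
  by_cases hw'' : w'' = w
  · subst hw''
    simp only [Function.update_self, hcCayPt, Matrix.cons_val_one, Matrix.cons_val_two, Matrix.head_cons, Matrix.tail_cons]
    by_cases hs : s = hcThird i j
    · simp [hs]
    · rw [if_neg hs]
      rcases eq_or_ne s i with rfl | hsi
      · simp [hp]
      · rcases eq_or_ne s j with rfl | hsj
        · simp [hp]
        · exact absurd (eq_hcThird_of_ne_ne_local hij hsi hsj) hs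
  · rw [Function.update_of_ne hw'', hcCayPt_apply_of_ne hw'']

end Letters

/-! ## §2 The two coordinate maps as continuous linear maps and the common word -/

section Charts

variable [Fintype W]

/-- **The compact-chart coordinates `c ↦ (π c, ν c)` are a continuous linear map** (`W → Fin 3 → ℝ` is finite-dimensional). [cite: Shelstad1979, §4 p. 25] -/
theorem exists_clm_wallChart (w : W) (i j : Fin 3) :
    ∃ A : (W → Fin 3 → ℝ) →L[ℝ] (W → Fin 3 → ℝ) × ℝ, ∀ c, A c = (c - ((c w i - c w j) / 2) • hcNrm w i j, (c w i - c w j) / 2) := by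
  let L : (W → Fin 3 → ℝ) →ₗ[ℝ] (W → Fin 3 → ℝ) × ℝ :=
    { toFun := fun c => (c - ((c w i - c w j) / 2) • hcNrm w i j, (c w i - c w j) / 2)
      map_add' := fun a b => by
        ext <;> simp only [Pi.add_apply, Prod.mk_add_mk, Pi.sub_apply, Pi.smul_apply, smul_eq_mul] <;> ring
      map_smul' := fun r a => by
        ext <;> simp only [Pi.smul_apply, smul_eq_mul, RingHom.id_apply, Prod.smul_mk, Pi.sub_apply] <;> ring }
  exact ⟨LinearMap.toContinuousLinearMap L, fun c => rfl⟩

/-- **The split-chart coordinates `c″ ↦ (B c″, x c″)` are a continuous linear map.** [cite: Shelstad1979, §4 p. 25] -/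
theorem exists_clm_cayleyChart (w : W) (i j : Fin 3) :
    ∃ A : (W → Fin 3 → ℝ) →L[ℝ] (W → Fin 3 → ℝ) × ℝ,
      ∀ c, A c = (Function.update c w (fun s => if s = hcThird i j then c w 1 else c w 2), c w 0) := by
  let L : (W → Fin 3 → ℝ) →ₗ[ℝ] (W → Fin 3 → ℝ) × ℝ :=
    { toFun := fun c => (Function.update c w (fun s => if s = hcThird i j then c w 1 else c w 2), c w 0)
      map_add' := fun a b => by
        refine Prod.ext ?_ (by simp)
        funext w' s
        by_cases hw' : w' = w
        · subst hw'
          simp only [Prod.fst_add, Pi.add_apply, Function.update_self]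
          split_ifs <;> rfl
        · simp only [Prod.fst_add, Pi.add_apply, Function.update_of_ne hw']
      map_smul' := fun r a => by
        refine Prod.ext ?_ (by simp)
        funext w' s
        by_cases hw' : w' = w
        · subst hw'
          simp only [Prod.smul_fst, Pi.smul_apply, smul_eq_mul, RingHom.id_apply, Function.update_self]
          split_ifs <;> rfl
        · simp only [Prod.smul_fst, Pi.smul_apply, smul_eq_mul, RingHom.id_apply, Function.update_of_ne hw'] }
  exact ⟨LinearMap.toContinuousLinearMap L, fun c => rfl⟩

omit [Fintype W] in
/-- **The adapted letters in the compact-chart coordinates**: `A (hcAdaptedVec l) = (0, 1)` for the normal letter, `(hcAdaptedVec l, 0)` otherwise. [cite: Shelstad1979, Lemma 4.3 (p. 25)] -/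
theorem wallChart_hcAdaptedVec {w : W} {i j : Fin 3} (hij : i ≠ j) {A : (W → Fin 3 → ℝ) →L[ℝ] (W → Fin 3 → ℝ) × ℝ}
    (hA : ∀ c, A c = (c - ((c w i - c w j) / 2) • hcNrm w i j, (c w i - c w j) / 2)) (l : W × Fin 3) :
    A (hcAdaptedVec w i j l) = if l = (w, i) then ((0 : W → Fin 3 → ℝ), (1 : ℝ)) else (hcAdaptedVec w i j l, 0) := by
  rw [hA, hcAdaptedVec_apply_sub hij]
  by_cases hl : l = (w, i)
  · rw [if_pos hl, if_pos hl, hl, hcAdaptedVec_normal]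
    refine Prod.ext ?_ (by norm_num)
    have := hcNrm_sub_smul_self hij w
    rw [hcNrm_apply_sub hij] at this
    exact this
  · rw [if_neg hl, if_neg hl]
    simp

omit [Fintype W] in
/-- **The Cayley letters in the split-chart coordinates**: `A₂ (hcCayVec l) = (0, 1)` for the normal letter, `(hcAdaptedVec l, 0)` otherwise — THE SAME word as the compact chart's.
[cite: Shelstad1979, Lemma 4.3 (p. 25)] [cite: Bouaziz1994IntegralesOrbitales, §3.2 (I₃) p. 580] -/
theorem cayleyChart_hcCayVec {w : W} {i j : Fin 3} (hij : i ≠ j) {A : (W → Fin 3 → ℝ) →L[ℝ] (W → Fin 3 → ℝ) × ℝ}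
    (hA : ∀ c, A c = (Function.update c w (fun s => if s = hcThird i j then c w 1 else c w 2), c w 0)) (l : W × Fin 3) :
    A (hcCayVec w i j l) = if l = (w, i) then ((0 : W → Fin 3 → ℝ), (1 : ℝ)) else (hcAdaptedVec w i j l, 0) := by
  rw [hA, hcCayVec_apply_zero w hij]
  by_cases hl : l = (w, i)
  · rw [if_pos hl, if_pos hl, hl, update_hcCayVec_normal_eq_zero]
  · rw [if_neg hl, if_neg hl, update_hcCayVec_eq_hcAdaptedVec w hij hl]

omit [Fintype W] in
/-- The compact chart reads the normal ray through a wall point `p` as `(p, t)`. [cite: Shelstad1979, §4 p. 25] -/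
theorem wallChart_add_smul_hcNrm {w : W} {i j : Fin 3} (hij : i ≠ j) {A : (W → Fin 3 → ℝ) →L[ℝ] (W → Fin 3 → ℝ) × ℝ}
    (hA : ∀ c, A c = (c - ((c w i - c w j) / 2) • hcNrm w i j, (c w i - c w j) / 2)) {p : W → Fin 3 → ℝ} (hp : p w i = p w j) (t : ℝ) :
    A (p + t • hcNrm w i j) = (p, t) := by
  have hν : ((p + t • hcNrm w i j) w i - (p + t • hcNrm w i j) w j) / 2 = t := by
    simp only [Pi.add_apply, Pi.smul_apply, smul_eq_mul]
    have := hcNrm_apply_sub hij w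
    linear_combination hp / 2 + t * this / 2
  rw [hA, hν]
  refine Prod.ext ?_ rfl
  simp

omit [Fintype W] in
/-- The split chart reads the Cayley point of a wall point `p` as `(p, 0)`. [cite: Shelstad1979, §4 p. 25] -/
theorem cayleyChart_hcCayPt {w : W} {i j : Fin 3} (hij : i ≠ j) {A : (W → Fin 3 → ℝ) →L[ℝ] (W → Fin 3 → ℝ) × ℝ}
    (hA : ∀ c, A c = (Function.update c w (fun s => if s = hcThird i j then c w 1 else c w 2), c w 0)) {p : W → Fin 3 → ℝ} (hp : p w i = p w j) :
    A (hcCayPt w i j p) = (p, 0) := by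
  rw [hA, update_hcCayPt_eq_self w hij hp, hcCayPt_apply_self_zero]

end Charts

/-! ## §3 Iterated derivatives through a continuous linear map on an open set; counting the normal letters -/

section Generic

/-- **Chain rule for `iteratedFDeriv` through a continuous linear map, locally**: `f` `C^∞` on an open `s ∋ A x` ⇒ `Dᵏ(f ∘ A)(x)(m) = Dᵏf(A x)(A ∘ m)`.
[cite: Bouaziz1994IntegralesOrbitales, §3.2 (I₃) p. 580] -/
theorem iteratedFDeriv_comp_clm_apply_of_isOpen {G E F : Type*} [NormedAddCommGroup G] [NormedSpace ℝ G] [NormedAddCommGroup E] [NormedSpace ℝ E]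
    [NormedAddCommGroup F] [NormedSpace ℝ F] (A : G →L[ℝ] E) {s : Set E} (hs : IsOpen s) {f : E → F} (hf : ContDiffOn ℝ ∞ f s) {x : G} (hx : A x ∈ s)
    (k : ℕ) (m : Fin k → G) :
    iteratedFDeriv ℝ k (f ∘ A) x m = iteratedFDeriv ℝ k f (A x) (A ∘ m) := by
  have hs' : IsOpen (A ⁻¹' s) := hs.preimage A.continuous
  rw [← iteratedFDerivWithin_of_isOpen k hs' hx, ← iteratedFDerivWithin_of_isOpen k hs hx,
    A.iteratedFDerivWithin_comp_right hf hs.uniqueDiffOn hs'.uniqueDiffOn hx (by exact_mod_cast le_top)]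
  rfl

/-- Counting the `true` letters of a word: `(List.ofFn σ).count true = #{r | σ r}`. [cite: Shelstad1979, Lemma 4.3 (p. 25)] -/
theorem count_ofFn_true_eq_card {k : ℕ} (σ : Fin k → Bool) : (List.ofFn σ).count true = (Finset.univ.filter fun r => σ r = true).card := by
  induction k with
  | zero => simp
  | succ k ih =>
    rw [List.ofFn_succ, List.count_cons, ih (fun r => σ r.succ), Finset.card_filter, Finset.card_filter, Fin.sum_univ_succ]
    cases σ 0 <;> simp [Nat.add_comm]

/-- The normal letters of a sub-word `m ∘ s↑` are the normal letters of `m` inside `s` (private copy of ★ `ArchTransfFamilyJumpLocal`'s lemma, light imports).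
[cite: Shelstad1979, Lemma 4.3 (p. 25)] -/
private theorem card_filter_subword_local {n : ℕ} {α : Type*} [DecidableEq α] (m : Fin n → α) (a : α) (s : Finset (Fin n)) :
    (Finset.univ.filter fun r : Fin s.card => m (s.orderEmbOfFin rfl r) = a).card = (s.filter fun r => m r = a).card := by
  rw [← Finset.card_map (s.orderEmbOfFin rfl).toEmbedding]
  congr 1
  ext r
  simp only [Finset.mem_map, Finset.mem_filter, Finset.mem_univ, true_and, RelEmbedding.coe_toEmbedding]
  constructor
  · rintro ⟨x, hx, rfl⟩
    exact ⟨Finset.orderEmbOfFin_mem s rfl x, hx⟩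
  · rintro ⟨hr, hm⟩
    have : r ∈ Set.range (s.orderEmbOfFin rfl) := by rw [Finset.range_orderEmbOfFin]; exact hr
    obtain ⟨x, rfl⟩ := this
    exact ⟨x, hm, rfl⟩

/-- The normal letters split between a subset and its complement. [cite: Shelstad1979, Lemma 4.3 (p. 25)] -/
theorem card_filter_add_card_filter_compl {n : ℕ} {α : Type*} [DecidableEq α] (m : Fin n → α) (a : α) (s : Finset (Fin n)) :
    (s.filter fun r => m r = a).card + (sᶜ.filter fun r => m r = a).card = (Finset.univ.filter fun r => m r = a).card := by
  rw [← Finset.card_union_of_disjoint (Finset.disjoint_filter_filter (disjoint_compl_right)), ← Finset.filter_union, Finset.union_compl]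

/-- **The Cayley scalar splits over a sub-word and its complement**: `I^{#normal(m∘s↑)} · I^{#normal(m∘sᶜ↑)} = hcCayScalar w i m`. [cite: Shelstad1979, Lemma 4.3 (p. 25)] -/
theorem I_pow_mul_I_pow_eq_hcCayScalar (w : W) (i : Fin 3) {n : ℕ} (m : Fin n → W × Fin 3) (s : Finset (Fin n)) :
    I ^ (Finset.univ.filter fun r : Fin s.card => m (s.orderEmbOfFin rfl r) = (w, i)).card *
      I ^ (Finset.univ.filter fun r : Fin sᶜ.card => m (sᶜ.orderEmbOfFin rfl r) = (w, i)).card = hcCayScalar w i m := by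
  rw [card_filter_subword_local, card_filter_subword_local, ← pow_add, card_filter_add_card_filter_compl]
  rfl

end Generic

/-! ## §4 The cofactor Wick identity in word form -/

section Wick

variable {P : Type*} [NormedAddCommGroup P] [NormedSpace ℝ P]

/-- The cofactor reader `(q, t) ↦ K·(c t·(y q).1 − (y q).2)` is `C^∞` on `Q ×ˢ univ` for a pair `y = (Π, E)` `C^∞` on `Q`. [cite: Varadarajan1977, I §1.12] -/
theorem contDiffOn_cofactorReader {Q : Set P} (c : ℝ → ℂ) (hc : ContDiff ℝ ∞ c) (K : ℂ) (y : P → Unit → ℂ × ℂ)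
    (hy : ContDiffOn ℝ ∞ (fun q => y q ()) Q) :
    ContDiffOn ℝ ∞ (fun z : P × ℝ => K * (c z.2 * (y z.1 ()).1 - (y z.1 ()).2)) (Q ×ˢ (univ : Set ℝ)) := by
  have h1 : ContDiffOn ℝ ∞ (fun z : P × ℝ => y z.1 ()) (Q ×ˢ (univ : Set ℝ)) := hy.comp contDiffOn_fst fun z hz => hz.1
  have hc' : ContDiffOn ℝ ∞ (fun z : P × ℝ => c z.2) (Q ×ˢ (univ : Set ℝ)) := (hc.comp contDiff_snd).contDiffOn
  exact contDiffOn_const.mul ((hc'.mul (contDiff_fst.comp_contDiffOn h1)).sub (contDiff_snd.comp_contDiffOn h1))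

/-- The transversal derivative of the cofactor reader is the cofactor reader of the differentiated pair. [cite: Varadarajan1977, I §1.12] -/
theorem fderiv_cofactorReader_transversal {Q : Set P} (hQ : IsOpen Q) (c : ℝ → ℂ) (hc : ContDiff ℝ ∞ c) (K : ℂ) (y : P → Unit → ℂ × ℂ)
    (hy : ContDiffOn ℝ ∞ (fun q => y q ()) Q) (v : P) {z : P × ℝ} (hz : z ∈ Q ×ˢ (univ : Set ℝ)) :
    fderiv ℝ (fun z : P × ℝ => K * (c z.2 * (y z.1 ()).1 - (y z.1 ()).2)) z (v, 0) =
      K * (c z.2 * (fderiv ℝ (fun q => y q ()) z.1 v).1 - (fderiv ℝ (fun q => y q ()) z.1 v).2) := by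
  have hyd : DifferentiableAt ℝ (fun q => y q ()) z.1 := ((hy.contDiffAt (hQ.mem_nhds hz.1)).differentiableAt (by simp))
  have hY : HasFDerivAt (fun z : P × ℝ => y z.1 ()) ((fderiv ℝ (fun q => y q ()) z.1).comp (ContinuousLinearMap.fst ℝ P ℝ)) z :=
    hyd.hasFDerivAt.comp z hasFDerivAt_fst
  have hY1 : HasFDerivAt (fun z : P × ℝ => (y z.1 ()).1)
      ((ContinuousLinearMap.fst ℝ ℂ ℂ).comp ((fderiv ℝ (fun q => y q ()) z.1).comp (ContinuousLinearMap.fst ℝ P ℝ))) z := hasFDerivAt_fst.comp z hY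
  have hY2 : HasFDerivAt (fun z : P × ℝ => (y z.1 ()).2)
      ((ContinuousLinearMap.snd ℝ ℂ ℂ).comp ((fderiv ℝ (fun q => y q ()) z.1).comp (ContinuousLinearMap.fst ℝ P ℝ))) z := hasFDerivAt_snd.comp z hY
  have hcd : DifferentiableAt ℝ c z.2 := (hc.differentiable (by simp)) z.2
  have hC : HasFDerivAt (fun z : P × ℝ => c z.2) ((fderiv ℝ c z.2).comp (ContinuousLinearMap.snd ℝ P ℝ)) z := hcd.hasFDerivAt.comp z hasFDerivAt_snd
  have h : HasFDerivAt (fun z : P × ℝ => K * (c z.2 * (y z.1 ()).1 - (y z.1 ()).2))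
      (K • (c z.2 • (ContinuousLinearMap.fst ℝ ℂ ℂ).comp ((fderiv ℝ (fun q => y q ()) z.1).comp (ContinuousLinearMap.fst ℝ P ℝ)) +
        (y z.1 ()).1 • (fderiv ℝ c z.2).comp (ContinuousLinearMap.snd ℝ P ℝ) -
        (ContinuousLinearMap.snd ℝ ℂ ℂ).comp ((fderiv ℝ (fun q => y q ()) z.1).comp (ContinuousLinearMap.fst ℝ P ℝ)))) z :=
    ((hC.mul hY1).sub hY2).const_mul K
  rw [h.fderiv]
  simp only [FunLike.coe_smul, FunLike.coe_sub, FunLike.coe_add, Pi.smul_apply, Pi.sub_apply, Pi.add_apply,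
    ContinuousLinearMap.comp_apply, ContinuousLinearMap.coe_fst', ContinuousLinearMap.coe_snd', smul_eq_mul, map_zero]
  ring

/-- **COFACTOR WICK IN WORD FORM.**  For `M_c(q,t) = K_c·(c t·Pf q − Ef q)` with `Pf, Ef` (the frozen root products `Π`, `E`) `C^∞` on the open `Q` and two `C^∞` profiles `ce, ch` with `iteratedDeriv a ce 0 = I^a · iteratedDeriv a ch 0`
(`2cos` and `2cosh` in the line), every word `w` of normal letters `(0,1)` (`σ r = true`) and transversal letters `(v,0)`, and every `q ∈ Q`:
`K₂ · Dᵏ M_{ce}(q,0)(w) = K₁ · I^{#normal} · Dᵏ M_{ch}(q,0)(w)` — the two cofactors are ONE analytic function read on the compact and on the split Cartan (Harish-Chandra's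
`|D_{G∕M}|^{1∕2}`), so their word jets at the wall differ exactly by `i` per normal letter. [cite: Varadarajan1977, I §1.12] [cite: Shelstad1979, Lemma 4.3 (p. 25)] -/
theorem cofactor_wick_words {Q : Set P} (hQ : IsOpen Q) (Pf Ef : P → ℂ) (hPf : ContDiffOn ℝ ∞ Pf Q) (hEf : ContDiffOn ℝ ∞ Ef Q)
    (ce ch : ℝ → ℂ) (hce : ContDiff ℝ ∞ ce) (hch : ContDiff ℝ ∞ ch) (hwick : ∀ a : ℕ, iteratedDeriv a ce 0 = I ^ a * iteratedDeriv a ch 0) (K₁ K₂ : ℂ)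
    {k : ℕ} (w : Fin k → P × ℝ) (σ : Fin k → Bool) (hwn : ∀ r, σ r = true → w r = ((0 : P), (1 : ℝ))) (hwt : ∀ r, σ r = false → (w r).2 = 0)
    {q : P} (hq : q ∈ Q) :
    K₂ * iteratedFDeriv ℝ k (fun z : P × ℝ => K₁ * (ce z.2 * Pf z.1 - Ef z.1)) (q, 0) w =
      K₁ * I ^ ((List.ofFn σ).count true) * iteratedFDeriv ℝ k (fun z : P × ℝ => K₂ * (ch z.2 * Pf z.1 - Ef z.1)) (q, 0) w := by
  -- two cofactor readers on the pair family `y q = (Π q, E q)`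
  let Φ : Bool → (Unit → ℂ × ℂ) → ℝ → ℂ := fun b y t => (if b then K₁ else K₂) * ((if b then ce t else ch t) * (y ()).1 - (y ()).2)
  let Adm : (P → Unit → ℂ × ℂ) → Prop := fun y => ContDiffOn ℝ ∞ (fun q => y q ()) Q
  let D : P → (P → Unit → ℂ × ℂ) → (P → Unit → ℂ × ℂ) := fun v y q _ => fderiv ℝ (fun q' => y q' ()) q v
  have hcl : ∀ y, Adm y → ∀ v, Adm (D v y) := fun y hy v => (hy.fderiv_of_isOpen hQ (by exact_mod_cast le_top)).clm_apply contDiffOn_const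
  have hprof : ∀ b : Bool, ContDiff ℝ ∞ (fun t => if b then ce t else ch t) := fun b => by cases b <;> simpa
  have h1 : ∀ (b : Bool) y, Adm y → ContDiffOn ℝ ∞ (fun z : P × ℝ => Φ b (y z.1) z.2) (Q ×ˢ (univ : Set ℝ)) := fun b y hy =>
    contDiffOn_cofactorReader (fun t => if b then ce t else ch t) (hprof b) _ y hy
  have h2 : ∀ (b : Bool) y, Adm y → ∀ (v : P) (z : P × ℝ), z ∈ Q ×ˢ (univ : Set ℝ) → fderiv ℝ (fun z : P × ℝ => Φ b (y z.1) z.2) z (v, 0) = Φ b (D v y z.1) z.2 :=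
    fun b y hy v z hz => fderiv_cofactorReader_transversal hQ (fun t => if b then ce t else ch t) (hprof b) _ y hy v hz
  let y : P → Unit → ℂ × ℂ := fun q _ => (Pf q, Ef q)
  have hy : Adm y := hPf.prodMk hEf
  obtain ⟨hAdm', hnf⟩ := Literature.Analysis.Calculus.iteratedFDeriv_readers_eq_iteratedDeriv_foldr_local hQ (fun _ : Bool => (univ : Set ℝ)) (fun _ => isOpen_univ)
    Φ Adm D hcl h1 h2 w σ hwn hwt y hy
  set y' := (List.ofFn fun r => (σ r, (w r).1)).foldr (fun l g => if l.1 then g else D l.2 g) y with hy'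
  have hz : ((q, (0 : ℝ)) : P × ℝ) ∈ Q ×ˢ (univ : Set ℝ) := ⟨hq, mem_univ _⟩
  have e1 := hnf true (q, 0) hz
  have e2 := hnf false (q, 0) hz
  simp only [Φ, if_true, Bool.false_eq_true, if_false, y] at e1 e2
  rw [e1, e2]
  -- the one-variable jets of `t ↦ K (c t A − B)` at `0`
  set a := (List.ofFn σ).count true
  obtain ⟨A, B⟩ := y' q ()
  have hjet : ∀ (K : ℂ) (c : ℝ → ℂ), ContDiff ℝ ∞ c →
      iteratedDeriv a (fun t => K * (c t * A - B)) 0 = K * (iteratedDeriv a c 0 * A - if a = 0 then B else 0) := by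
    intro K c hc
    have hcA : ContDiffAt ℝ (a : ℕ∞) (fun t => c t * A) (0 : ℝ) := ((hc.of_le (by exact_mod_cast le_top)).mul contDiff_const).contDiffAt
    have hB : ContDiffAt ℝ (a : ℕ∞) (fun _ : ℝ => B) (0 : ℝ) := contDiffAt_const
    rw [iteratedDeriv_const_mul_field, show (fun t => c t * A - B) = (fun t => c t * A) - fun _ => B from rfl,
      iteratedDeriv_sub hcA hB, iteratedDeriv_mul_const_field, iteratedDeriv_const]
  simp only []
  rw [hjet K₁ ce hce, hjet K₂ ch hch, hwick a]
  by_cases ha : a = 0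
  · simp [ha]; ring
  · simp [ha]; ring

end Wick

end Literature.NumberTheory.Rogawski1990
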